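import Literature.NumberTheory.GaloisCohomology.Howard2004.DVRLevelTorsionControlProofs
import Literature.NumberTheory.GaloisCohomology.Howard2004.DVRLevelSelmerFiniteProofs
import Literature.NumberTheory.GaloisCohomology.Howard2004.ResidualDualityDatumProofs
import Literature.NumberTheory.GaloisCohomology.Howard2004.TransverseCartesianProofs
import Literature.NumberTheory.GaloisCohomology.Howard2004.PropagateUnramifiedProofs
import HarnessLib

/-!
# Howard 2004, Lemma 1.3.3 between the RESIDUAL representation `T̄` and a level `T^{(k)}` of a
# `DVRSetting`: `H¹(K, T̄) ≅ H¹(K, T^{(k)})[𝔪]`, Selmer-compatibly for `F` and `F(n)` (theorems only)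

Topic `NumberTheory/GaloisCohomology/Howard2004` (sequel to `DVRLevelTorsionControlProofs` = Lemma 1.3.3 for
two LEVELS `(k, k+1)` of the tower, and to `TransverseCartesianProofs` = the same for `F(n)`).  THEOREMS ONLY:
no definition, no named fact, no instance, no notation, no `sorry`.

WHY (INPUTS row G87 = `Howard2004.thm161_dvrKolyvaginBound` = Howard Thm. 1.6.1; stub `stub_h161` of the
μ-crux stmt-BirchSwinnertonDyer-22642; cell `pub/bsd-print-x9`, seat `bsd-line-x10b-p1-w8` g10, brick
«RES-CTRL» named by x10b-p1-w7 g7).  The proof of Lemma 1.6.4 (arXiv:1202.6340 Lemma 2.6.4, p. 11 L82 – p. 12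
L27) reads the socle `H¹_{F(n)}(K, T^{(k)})[𝔪]` of the level-`k` Selmer group AS the residual Selmer group
`H¹_{F(n)}(K, T̄)`: «it has some nonzero multiple `d ∈ H¹_{F(n)}(K,T^{(k)})[𝔪]` … both `d⁺` and some element of
`H¹_{F(n)}(K,T̄)⁻` have nontrivial localization» (Case i, p. 12 L2–6), and «By Lemma (H.5 application),
`ρ(n) = 0` or `1` implies that `Stub^{(k)}(n) = H¹_{F(n)}(K, T^{(k)})`» (p. 11 L95–97) where
`ρ(n)^± = dim_{R/𝔪} H¹_{F(n)}(K, T̄)^±`.  Both use Lemma 1.3.3 «the maps `T/𝔪^iT → T[𝔪^i] → T` induce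
isomorphisms `H¹_F(K, T/𝔪^iT) → H¹_F(K, T[𝔪^i]) → H¹_F(K, T)[𝔪^i]`» (arXiv Lemma 2.3.3, p. 7 L152–160) for the
principal Artinian `R_k`-module `T^{(k)}` and `i = 1`: `T̄ = T^{(k)}/𝔪T^{(k)} ≅ T^{(k)}[𝔪] = π^{e_k-1}T^{(k)}`.
The tree has a residual presentation `π̄_k : T^{(k)} ↠ T̄` on its own carrier `Nbar` (H.1) but NO map
`T̄ → T^{(k)}`; this file supplies it and proves Lemma 1.3.3 along it, for ANY `DVRSetting` with H.0–H.5
(no assumption that the tower has a level of exponent `1`: the statement is level-interpolation-free).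

THE MAP.  The **residual inclusion** at level `k` is any `R_k`-linear `ι : T̄ → T^{(k)}` with
`ι (π̄_k y) = π^{e_k-1} · y` (well defined since `π^{e_k-1} 𝔪 T^{(k)} = 0`; it exists and is unique as `π̄_k`
is onto — §1 `exists_residualInclusion`); all statements quantify over such an `ι` (hypothesis `hι`).

* §0 (generic) `cohomologyMap_one_injective_of_forall_fixed` — `H¹(F, f)` is injective for an injective
  equivariant `f : M₁ → M₂` of discrete `Γ_F`-modules with `(M₂/f M₁)^{Γ_F} = 0` (long exact sequence).
* §1 (the module map) `maximalIdeal_smul_residual_eq_zero` (`𝔪_{R_k} T̄ = 0`), **`exists_residualInclusion`**,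
  and for any `ι` with `hι`: `residualInclusion_equivariant`, `residualInclusion_injective` (H.0),
  `mem_range_residualInclusion_iff` (`im ι = π^{e_k-1}T^{(k)}`), `mem_range_residualInclusion_of_smul_eq_zero`
  (`T^{(k)}[π] ⊆ im ι`, H.0), `pi_smul_residualInclusion_eq_zero`, `mem_range_residualInclusion_of_forall`
  (`(coker ι)^{Γ_K} = 0`: no fixed vector modulo `π^{e_k-1}`, H.0 + H.1 via w2 g14's dévissage).
* §2 (global) **`cohomologyMap_residualInclusion_injective`** (`H¹(K, ι)` injective),
  `scalarMapH1_pi_cohomologyMap_residualInclusion` (`π · H¹(ι) c̄ = 0`) and **(Z̄)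
  `exists_cohomologyMap_residualInclusion_eq_of_scalarMapH1_eq_zero`** (`π c = 0 ⇒ c ∈ im H¹(K, ι)`: the short
  exact sequence `0 → T̄ →(ι) T^{(k)} →(π·) πT^{(k)} → 0`), i.e. `H¹(K, ι) : H¹(K, T̄) ≅ H¹(K, T^{(k)})[𝔪]`.
* §3 (local, every place) **`comap_residualInclusionLoc_cond_eq`**: `H¹(K_v, ι)⁻¹(F_{k,v}) = F̄_v`, where `F̄` is
  `F_k` PROPAGATED to `T̄` along `π̄_k` (Def. 1.1.3; the structure of H.5(b), `SatisfiesH.h5b`) — at `v ∈ Σ(F)`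
  this is H.3 (`F_k` cartesian on `Quot(T^{(k)})`) for the presentations `π̄_k`, `id` and the `Quot`-morphism
  `ι` («multiplication by `π^{e_k-1}`»); off `Σ(F)` both sides are the unramified condition on `T̄` («unramified
  cartesian» + `IsQuotientBy.propagateStructure_inr_eq_unramifiedSubgroup`); **Selmer descent**
  `cohomologyMap_residualInclusion_mem_selmerGroup_iff` and **Lemma 1.3.3 (`i = 1`) at level `k`**
  `exists_mem_selmerGroup_cohomologyMap_residualInclusion_eq_iff`:
  `(∃ c̄ ∈ H¹_{F̄}(K, T̄), H¹(ι) c̄ = c) ↔ c ∈ H¹_F(K, T^{(k)}) ∧ π c = 0`.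
* §4 the same for `F(n)` (Def. 1.2.2: transverse at the primes of `n`, on `T^{(k)}` AND on `T̄`), for `n` a
  finite set of primes at which `Γ_L` acts trivially on `T^{(k)}` (print: `n ∈ 𝓝^{(k)}`; hypothesis `htriv` in
  the shape of `TransverseCartesianProofs`, Lemma 1.5.1): `comap_residualInclusionLoc_atLevel_cond_eq`,
  `cohomologyMap_residualInclusion_mem_selmerGroup_atLevel_iff`,
  **`exists_mem_selmerGroup_atLevel_cohomologyMap_residualInclusion_eq_iff`** — the «(H.5 application)»
  identification `H¹_{F(n)}(K, T̄) ≅ H¹_{F(n)}(K, T^{(k)})[𝔪]` of the proof of Lemma 1.6.4.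

Print: Howard, Compositio Math. 140 (2004) = arXiv:1202.6340, Lemma 1.3.3 (arXiv 2.3.3, p. 7 L152–160, proof =
«Remark (cartesian identifications) and Lemma 3.5.4 of [MR04]»), H.0/H.1/H.3 (p. 7 L57–67), Lemma 1.5.1 (p. 9
L127–133), Lemma 1.6.4 proof (p. 11 L95–97, p. 12 L1–27).  HONEST FRAMING: `thm161_dvrKolyvaginBound` is NOT proved
(Prop. 1.4.1/Thm. 1.4.2, the instantiation of Lemma 1.6.4's induction, conclusion (ii) remain); no summit statement
is proved; the Birch–Swinnerton-Dyer conjecture is not proved by any of this.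
References: [Howard2004HeegnerKolyvagin] Lemma 1.3.3, H.0–H.3, Def. 1.1.2–1.1.3, 1.2.2, Lemma 1.5.1, Lemma 1.6.4;
[MazurRubinMemoirs2004] Lemma 3.5.4, Lemma 3.7.4; [SerreGaloisCohomology1997] I §2.2; [MilneADT2006] I §2.
-/

set_option autoImplicit false

noncomputable section

open Function NumberField IsDedekindDomain Field
open scoped NumberField ContRepresentation Pointwise

namespace Literature.NumberTheory.GaloisCohomology.Howard2004

open CategoryTheory
open Literature.NumberTheory.GaloisRepresentations
open Literature.NumberTheory.GaloisRepresentations.DiscreteGaloisModule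
open Literature.NumberTheory.GaloisCohomology.Howard2004.LevelRaising

/-! ## §0 Generic: `H¹(f)` is injective for `f` injective with invariant-free cokernel -/

section Generic

variable {F : Type} [Field F] {A : Type} [Ring A]
  {M₁ : Type} [AddCommGroup M₁] [TopologicalSpace M₁] [DiscreteTopology M₁] [Module A M₁]
  {M₂ : Type} [AddCommGroup M₂] [TopologicalSpace M₂] [DiscreteTopology M₂] [Module A M₂]

/-- **`H¹(F, f) : H¹(F, M₁) → H¹(F, M₂)` is injective for an injective equivariant `f` whose cokernel
`M₂/f(M₁)` has no non-zero `Γ_F`-fixed vector** — the long exact sequence of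
`0 → M₁ →(f) M₂ → M₂/f(M₁) → 0` (tree `IsSES`, `ContinuousRep.mkQHom`) in degrees `0 → 1`; the shape of
the injectivity in Howard's Lemma 1.3.3 / Mazur–Rubin's Lemma 3.5.4 for an arbitrary map.
[cite: SerreGaloisCohomology1997, I §2.2] [cite: MazurRubinMemoirs2004, Lemma 3.5.4] -/
theorem cohomologyMap_one_injective_of_forall_fixed [CompactSpace (absoluteGaloisGroup F)]
    (τ₁ : DiscreteGaloisModule F M₁) (τ₂ : DiscreteGaloisModule F M₂) (f : M₁ →ₗ[A] M₂)
    (hf : ∀ (g : absoluteGaloisGroup F) (x : M₁), f (τ₁ g x) = τ₂ g (f x))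
    (hinj : Function.Injective f)
    (hfix : ∀ z : M₂, (∀ g : absoluteGaloisGroup F, τ₂ g z - z ∈ LinearMap.range f) →
      z ∈ LinearMap.range f) :
    Function.Injective (ContinuousRep.cohomologyMap τ₁ τ₂ f.toAddMonoidHom continuous_of_discreteTopology
      hf 1) := by
  refine (injective_iff_map_eq_zero _).2 fun c hc => ?_
  set W : Submodule ℤ M₂ := (LinearMap.range f).restrictScalars ℤ
  have hW : ∀ g, W ≤ W.comap (τ₂ g) := by
    rintro g _ ⟨x, rfl⟩
    exact ⟨τ₁ g x, hf g x⟩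
  let fh : τ₁.toTopRep ⟶ τ₂.toTopRep :=
    TopRep.ofHom ⟨⟨f.toAddMonoidHom.toIntLinearMap, continuous_of_discreteTopology⟩,
      fun g => ContinuousLinearMap.ext fun x => hf g x⟩
  have hSES : IsSES fh (τ₂.mkQHom W hW) :=
    { comp_eq_zero := by
        ext x
        change Submodule.Quotient.mk (p := W) (f x) = 0
        exact (Submodule.Quotient.mk_eq_zero W).2 ⟨x, rfl⟩
      injective := fun a b h => hinj h
      exact_mid := fun y hy => (Submodule.Quotient.mk_eq_zero W).1 hy
      surjective := Submodule.Quotient.mk_surjective W }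
  have h0 : Subsingleton (continuousCohomology 0 (τ₂.quotient W hW).toTopRep) :=
    subsingleton_continuousCohomology_zero_of_forall_eq_zero _ fun q hq => by
      induction q using Submodule.Quotient.induction_on with
      | _ z =>
        exact (Submodule.Quotient.mk_eq_zero W).2
          (hfix z fun g => (Submodule.Quotient.eq W).1 (hq g))
  have hc' : cohomologyMap fh 1 c = 0 := hc
  exact hSES.cohomologyMap_one_eq_zero_imp h0 c hc'

end Generic

/-! ## §1 The residual inclusion `ι : T̄ → T^{(k)}`, `ι (π̄_k y) = π^{e_k - 1} y` -/

namespace DVRSetting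

variable {p : ℕ} [Fact p.Prime] {K : Type} [Field K] [NumberField K]
  {R : Type} [CommRing R] [IsDomain R] [IsDiscreteValuationRing R] [Algebra ℤ_[p] R]
  {N : ℕ → Type} [∀ k, AddCommGroup (N k)] [∀ k, TopologicalSpace (N k)]
  [∀ k, DiscreteTopology (N k)] [∀ k, Module R (N k)]
  {Rk : ℕ → Type} [∀ k, CommRing (Rk k)] [∀ k, IsLocalRing (Rk k)] [∀ k, TopologicalSpace (Rk k)]
  [∀ k, DiscreteTopology (Rk k)] [∀ k, Algebra ℤ_[p] (Rk k)] [∀ k, Algebra R (Rk k)]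
  [∀ k, Module (Rk k) (N k)] [∀ k, IsScalarTower R (Rk k) (N k)]
  {Nbar : Type} [AddCommGroup Nbar] [TopologicalSpace Nbar] [DiscreteTopology Nbar]
  [∀ k, Module (Rk k) Nbar]
  {Nq : ℕ → Finset (HeightOneSpectrum (𝓞 K)) → Type} [∀ k n, AddCommGroup (Nq k n)]
  [∀ k n, TopologicalSpace (Nq k n)] [∀ k n, DiscreteTopology (Nq k n)]
  [∀ k n, Module (Rk k) (Nq k n)] [∀ k n, Module R (Nq k n)]
  [∀ k n, IsScalarTower R (Rk k) (Nq k n)]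

/-- **`𝔪_{R_k} · T̄ = 0`**: `T̄ = T^{(k)}/𝔪 T^{(k)}` (H.1 presentation, `π̄_k` onto with kernel `𝔪 T^{(k)}`).
[cite: Howard2004HeegnerKolyvagin, H.1 (arXiv p. 7, L59: «`T̄ = T/𝔪T`»)] -/
theorem maximalIdeal_smul_residual_eq_zero (S : DVRSetting p K R N Rk Nbar Nq) (hy : S.SatisfiesH) (k : ℕ)
    {a : Rk k} (ha : a ∈ IsLocalRing.maximalIdeal (Rk k)) (x : Nbar) : a • x = 0 := by
  obtain ⟨hq, -, -, -⟩ := hy.h1 k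
  obtain ⟨y, rfl⟩ := hq.surjective x
  rw [← map_smul, ← LinearMap.mem_ker, hq.ker_eq]
  exact Submodule.smul_mem_smul ha Submodule.mem_top

/-- `π · T̄ = 0` (the scalar `π ∈ R` acting through `R_k`). [cite: Howard2004HeegnerKolyvagin, H.1 (arXiv p. 7, L59)] -/
theorem algebraMap_pi_smul_residual_eq_zero (S : DVRSetting p K R N Rk Nbar Nq) (hy : S.SatisfiesH)
    (k : ℕ) (x : Nbar) : algebraMap R (Rk k) S.π • x = 0 :=
  S.maximalIdeal_smul_residual_eq_zero hy k ((IsLocalRing.mem_maximalIdeal _).2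
    (algebraMap_mem_nonunits S.π (S.e k)
      (by rw [hy.ker_algebraMap]; exact Ideal.pow_mem_pow (S.π_mem_maximalIdeal hy) _))) x

/-- **The residual inclusion exists**: there is an `R_k`-linear `ι : T̄ → T^{(k)}` with
`ι (π̄_k y) = π^{e_k-1} · y` — multiplication by `π^{e_k-1}` kills `ker π̄_k = 𝔪 T^{(k)}` (`𝔪_{R_k} = π R_k`,
`π^{e_k} = 0` in `R_k`), so it factors through `T̄ = T^{(k)}/𝔪T^{(k)}`.  This is the `Quot(T^{(k)})`-morphism
`T^{(k)}/𝔪 → T^{(k)}/0` «induced by scalar multiplication by `π^{e_k-1}`» (Def. 1.1.3), i.e. Howard's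
`T/𝔪T ≅ T[𝔪] ⊂ T` for the length-`e_k` principal Artinian module `T^{(k)}`.
[cite: Howard2004HeegnerKolyvagin, Lemma 1.3.3 and Def. 1.1.3 (arXiv p. 7 L152–160, p. 5 L93–99)] -/
theorem exists_residualInclusion (S : DVRSetting p K R N Rk Nbar Nq) (hy : S.SatisfiesH) (k : ℕ) :
    ∃ ι : Nbar →ₗ[Rk k] N k, ∀ y : N k, ι (S.πbar k y) = S.π ^ (S.e k - 1) • y := by
  obtain ⟨hq, -, -, -⟩ := hy.h1 k
  set ϖ : Rk k := algebraMap R (Rk k) S.π with hϖ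
  have hkill : LinearMap.ker (S.πbar k) ≤ LinearMap.ker (ϖ ^ (S.e k - 1) • (LinearMap.id : N k →ₗ[Rk k] N k)) := by
    rw [hq.ker_eq]
    refine Submodule.smul_le.mpr fun a ha y _ => ?_
    rw [LinearMap.mem_ker, LinearMap.smul_apply, LinearMap.id_apply, smul_smul]
    obtain ⟨a', rfl⟩ := S.exists_eq_algebraMap_pi_mul hy k a ha
    rw [← mul_assoc, ← pow_succ, Nat.sub_add_cancel (S.one_le_e hy k), hϖ, S.algebraMap_pi_pow_e hy k,
      zero_mul, zero_smul]
  refine ⟨((LinearMap.ker (S.πbar k)).liftQ (ϖ ^ (S.e k - 1) • LinearMap.id) hkill).comp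
    ((S.πbar k).quotKerEquivOfSurjective hq.surjective).symm.toLinearMap, fun y => ?_⟩
  have h1 : ((S.πbar k).quotKerEquivOfSurjective hq.surjective).symm (S.πbar k y) =
      Submodule.Quotient.mk y := by
    rw [LinearEquiv.symm_apply_eq]
    rfl
  simp only [LinearMap.coe_comp, LinearEquiv.coe_coe, Function.comp_apply, h1, Submodule.liftQ_apply,
    LinearMap.smul_apply, LinearMap.id_apply]
  rw [hϖ, ← map_pow, algebraMap_smul]

variable (S : DVRSetting p K R N Rk Nbar Nq)

/-- The residual inclusion is `Γ_K`-equivariant (`π̄_k` is, and the action on `T^{(k)}` is `R`-linear).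
[cite: Howard2004HeegnerKolyvagin, Lemma 1.3.3 (arXiv p. 7 L152–160)] -/
theorem residualInclusion_equivariant (hy : S.SatisfiesH) (k : ℕ) (ι : Nbar →ₗ[Rk k] N k)
    (hι : ∀ y : N k, ι (S.πbar k y) = S.π ^ (S.e k - 1) • y) (σ : absoluteGaloisGroup K) (x : Nbar) :
    ι (S.ρbar σ x) = S.T.ρ k σ (ι x) := by
  obtain ⟨hq, -, -, -⟩ := hy.h1 k
  obtain ⟨y, rfl⟩ := hq.surjective x
  rw [← hq.equivariant, hι, hι, S.T.hlin k]

/-- **`im ι = π^{e_k-1} T^{(k)}`** (`π̄_k` is onto). [cite: Howard2004HeegnerKolyvagin, Lemma 1.3.3 (arXiv p. 7 L152–160: «`T[𝔪^i]`»)] -/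
theorem mem_range_residualInclusion_iff (hy : S.SatisfiesH) (k : ℕ) (ι : Nbar →ₗ[Rk k] N k)
    (hι : ∀ y : N k, ι (S.πbar k y) = S.π ^ (S.e k - 1) • y) (z : N k) :
    z ∈ LinearMap.range ι ↔ ∃ w, z = S.π ^ (S.e k - 1) • w := by
  obtain ⟨hq, -, -, -⟩ := hy.h1 k
  constructor
  · rintro ⟨x, rfl⟩
    obtain ⟨w, rfl⟩ := hq.surjective x
    exact ⟨w, hι w⟩
  · rintro ⟨w, rfl⟩
    exact ⟨S.πbar k w, hι w⟩

/-- **`ι` is injective**: `ι (π̄_k y) = π^{e_k-1} y = 0` forces `y ∈ π T^{(k)}` (H.0: `T^{(k)}` free over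
`R_k = R/π^{e_k}`), and `π̄_k (π y') = 0` (`π T̄ = 0`). [cite: Howard2004HeegnerKolyvagin, Lemma 1.3.3 and H.0 (arXiv p. 7 L57, L152–160)] -/
theorem residualInclusion_injective (hy : S.SatisfiesH) (k : ℕ) (ι : Nbar →ₗ[Rk k] N k)
    (hι : ∀ y : N k, ι (S.πbar k y) = S.π ^ (S.e k - 1) • y) : Function.Injective ι := by
  obtain ⟨hq, -, -, -⟩ := hy.h1 k
  refine (injective_iff_map_eq_zero _).2 fun x hx => ?_
  obtain ⟨y, rfl⟩ := hq.surjective x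
  rw [hι] at hx
  obtain ⟨y', rfl⟩ := S.exists_eq_smul_of_pow_smul_eq_zero hy k
    (Nat.sub_lt (S.one_le_e hy k) Nat.one_pos) y hx
  rw [← algebraMap_smul (Rk k) S.π y', map_smul]
  exact S.algebraMap_pi_smul_residual_eq_zero hy k _

/-- **`T^{(k)}[π] ⊆ im ι`**: `π z = 0` forces `z ∈ π^{e_k-1} T^{(k)}` (H.0). [cite: Howard2004HeegnerKolyvagin, Lemma 1.3.3 and H.0 (arXiv p. 7 L57, L152–160: «`T/𝔪^iT → T[𝔪^i]`»)] -/
theorem mem_range_residualInclusion_of_smul_eq_zero (hy : S.SatisfiesH) (k : ℕ) (ι : Nbar →ₗ[Rk k] N k)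
    (hι : ∀ y : N k, ι (S.πbar k y) = S.π ^ (S.e k - 1) • y) (z : N k) (hz : S.π • z = 0) :
    z ∈ LinearMap.range ι := by
  haveI := (hy.h0 k).1
  obtain ⟨w, rfl⟩ := exists_eq_pow_smul_of_pow_smul_eq_zero S.π (S.π_ne_zero hy) (S.e k)
    (hy.algebraMap_surjective k) (S.ker_algebraMap_le hy k) (S.one_le_e hy k) z (by rwa [pow_one])
  exact (S.mem_range_residualInclusion_iff hy k ι hι _).2 ⟨w, rfl⟩

/-- `π · ι x = 0` (`π · π^{e_k-1} = π^{e_k}` kills `T^{(k)}`). [cite: Howard2004HeegnerKolyvagin, Lemma 1.3.3 (arXiv p. 7 L152–160)] -/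
theorem pi_smul_residualInclusion_eq_zero (hy : S.SatisfiesH) (k : ℕ) (ι : Nbar →ₗ[Rk k] N k)
    (hι : ∀ y : N k, ι (S.πbar k y) = S.π ^ (S.e k - 1) • y) (x : Nbar) : S.π • ι x = 0 := by
  obtain ⟨hq, -, -, -⟩ := hy.h1 k
  obtain ⟨y, rfl⟩ := hq.surjective x
  rw [hι, smul_smul, ← pow_succ', Nat.sub_add_cancel (S.one_le_e hy k)]
  exact hy.killed k _ (Ideal.pow_mem_pow (S.π_mem_maximalIdeal hy) _) y

/-- **`(coker ι)^{Γ_K} = 0`**: if `σ z ≡ z (mod im ι = π^{e_k-1}T^{(k)})` for every `σ` then `z ∈ im ι` — no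
`Γ_K`-fixed vector modulo `π^{e_k-1}` (w2 g14's dévissage `exists_eq_pow_smul_of_forall` from H.0 + H.1).
[cite: Howard2004HeegnerKolyvagin, Lemma 1.3.3 and H.0–H.1 (arXiv p. 7 L57–59, L152–160)] [cite: MazurRubinMemoirs2004, Lemma 3.5.4] -/
theorem mem_range_residualInclusion_of_forall (hy : S.SatisfiesH) (k : ℕ) (ι : Nbar →ₗ[Rk k] N k)
    (hι : ∀ y : N k, ι (S.πbar k y) = S.π ^ (S.e k - 1) • y) (z : N k)
    (hz : ∀ g : absoluteGaloisGroup K, S.T.ρ k g z - z ∈ LinearMap.range ι) :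
    z ∈ LinearMap.range ι := by
  rw [S.mem_range_residualInclusion_iff hy k ι hι]
  refine S.exists_eq_pow_smul_of_forall hy k (Nat.sub_le _ _) z fun σ => ?_
  obtain ⟨w, hw⟩ := (S.mem_range_residualInclusion_iff hy k ι hι _).1 (hz σ)
  exact ⟨w, hw⟩

/-! ## §2 (Z̄) `H¹(K, ι) : H¹(K, T̄) ≅ H¹(K, T^{(k)})[𝔪]` -/

/-- **`H¹(K, ι) : H¹(K, T̄) → H¹(K, T^{(k)})` is injective** (`ι` injective, `(coker ι)^{Γ_K} = 0`, §0) — the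
injectivity in Lemma 1.3.3 for `T/𝔪T → T` at the level `T = T^{(k)}`.
[cite: Howard2004HeegnerKolyvagin, Lemma 1.3.3 (arXiv p. 7 L152–160)] [cite: MazurRubinMemoirs2004, Lemma 3.5.4] -/
theorem cohomologyMap_residualInclusion_injective (hy : S.SatisfiesH) (k : ℕ) (ι : Nbar →ₗ[Rk k] N k)
    (hι : ∀ y : N k, ι (S.πbar k y) = S.π ^ (S.e k - 1) • y)
    (hequiv : ∀ (σ : absoluteGaloisGroup K) (x : Nbar), ι (S.ρbar σ x) = S.T.ρ k σ (ι x)) :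
    Function.Injective (ContinuousRep.cohomologyMap S.ρbar (S.T.ρ k) ι.toAddMonoidHom
      continuous_of_discreteTopology hequiv 1) :=
  cohomologyMap_one_injective_of_forall_fixed S.ρbar (S.T.ρ k) ι hequiv
    (S.residualInclusion_injective hy k ι hι) (S.mem_range_residualInclusion_of_forall hy k ι hι)

/-- **`π · H¹(K, ι) c̄ = 0`**: the image of `H¹(K, T̄)` lies in the `𝔪`-torsion of `H¹(K, T^{(k)})`
(`H¹(π ·) ∘ H¹(ι) = H¹(π · ι) = H¹(0)`). [cite: Howard2004HeegnerKolyvagin, Lemma 1.3.3 (arXiv p. 7 L152–160: «`H¹_F(K, T)[𝔪^i]`»)] -/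
theorem scalarMapH1_pi_cohomologyMap_residualInclusion (hy : S.SatisfiesH) (k : ℕ) (ι : Nbar →ₗ[Rk k] N k)
    (hι : ∀ y : N k, ι (S.πbar k y) = S.π ^ (S.e k - 1) • y)
    (hequiv : ∀ (σ : absoluteGaloisGroup K) (x : Nbar), ι (S.ρbar σ x) = S.T.ρ k σ (ι x))
    (c : galoisCohomology S.ρbar 1) :
    galoisCohomology.scalarMapH1 (S.T.ρ k) (S.T.hlin k) S.π
      (ContinuousRep.cohomologyMap S.ρbar (S.T.ρ k) ι.toAddMonoidHom continuous_of_discreteTopology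
        hequiv 1 c) = 0 := by
  have hsq := cohomologyMap_one_comm_sq S.ρbar (S.T.ρ k) S.ρbar (S.T.ρ k)
    ι.toAddMonoidHom hequiv (DistribSMul.toAddMonoidHom (N k) S.π)
    (fun g y => (S.T.hlin k g S.π y).symm) (0 : Nbar →+ Nbar) (fun _ _ => by simp)
    (0 : Nbar →+ N k) (fun _ _ => by simp) (fun x => by
      change S.π • ι x = (0 : Nbar →+ N k) ((0 : Nbar →+ Nbar) x)
      rw [S.pi_smul_residualInclusion_eq_zero hy k ι hι x, AddMonoidHom.zero_apply]) c
  rw [cohomologyMap_smul_eq_scalarMapH1 _ (S.T.hlin k)] at hsq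
  rw [hsq]
  obtain ⟨z, rfl⟩ := oneCocycleClass_surjective S.ρbar.toTopRep c
  rw [cohomologyMap_one_oneCocycleClass, cohomologyMap_one_oneCocycleClass]
  refine (oneCocycleClass_eq_zero_iff _ _).2 ⟨0, fun g => ?_⟩
  change (0 : Nbar →+ N k) ((0 : Nbar →+ Nbar) (z.1 g)) = _
  simp

/-- **(Z̄) Torsion control: a class of `H¹(K, T^{(k)})` killed by `π` is in the image of `H¹(K, ι)`.**  The
sequence `0 → T̄ →(ι) T^{(k)} →(π·) πT^{(k)} → 0` is short exact (H.0: `ker (π·) = T^{(k)}[π] = π^{e_k-1}T^{(k)} =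
im ι`), so by the long exact sequence a class killed by `H¹(π· : T^{(k)} → πT^{(k)})` comes from `H¹(K, T̄)`;
and `H¹(π·) c = 0` as soon as `π c = 0` because `H¹(K, πT^{(k)}) → H¹(K, T^{(k)})` is injective (w2 g14's
`cohomologyMap_subtype_pow_smul_injective`, no fixed vector modulo `π`) and the composite is the scalar `π` on
`H¹`.  Lemma 1.3.3 = [MR04, Lemma 3.5.4] for `T/𝔪T → T` at the level `T^{(k)}`.
[cite: Howard2004HeegnerKolyvagin, Lemma 1.3.3 (arXiv p. 7 L152–160)] [cite: MazurRubinMemoirs2004, Lemma 3.5.4] [cite: SerreGaloisCohomology1997, I §2.2] -/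
theorem exists_cohomologyMap_residualInclusion_eq_of_scalarMapH1_eq_zero (hy : S.SatisfiesH) (k : ℕ)
    (ι : Nbar →ₗ[Rk k] N k) (hι : ∀ y : N k, ι (S.πbar k y) = S.π ^ (S.e k - 1) • y)
    (hequiv : ∀ (σ : absoluteGaloisGroup K) (x : Nbar), ι (S.ρbar σ x) = S.T.ρ k σ (ι x))
    (c : galoisCohomology (S.T.ρ k) 1)
    (hc : galoisCohomology.scalarMapH1 (S.T.ρ k) (S.T.hlin k) S.π c = 0) :
    ∃ c' : galoisCohomology S.ρbar 1,
      ContinuousRep.cohomologyMap S.ρbar (S.T.ρ k) ι.toAddMonoidHom continuous_of_discreteTopology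
        hequiv 1 c' = c := by
  haveI := (hy.h0 k).1
  -- the submodule `π T^{(k)}` and the corestricted multiplication
  set W : Submodule ℤ (N k) := ((S.π ^ 1) • (⊤ : Submodule R (N k))).restrictScalars ℤ
  have hW : ∀ g, W ≤ W.comap (S.T.ρ k g) := S.pow_smul_top_le_comap k 1
  have hmemW : ∀ z : N k, S.π ^ 1 • z ∈ W := fun z =>
    Submodule.smul_mem_pointwise_smul _ _ ⊤ Submodule.mem_top
  let μ : N k →+ ↥W :=
    { toFun := fun z => ⟨S.π ^ 1 • z, hmemW z⟩
      map_zero' := Subtype.ext (smul_zero _)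
      map_add' := fun x y => Subtype.ext (smul_add _ _ _) }
  have hμ : ∀ (g : absoluteGaloisGroup K) (z : N k),
      μ (S.T.ρ k g z) = (S.T.ρ k).subrepresentation W hW g (μ z) := fun g z =>
    Subtype.ext (by change S.π ^ 1 • S.T.ρ k g z = S.T.ρ k g (S.π ^ 1 • z)
                    rw [S.T.hlin k g])
  let f : S.ρbar.toTopRep ⟶ (S.T.ρ k).toTopRep :=
    TopRep.ofHom ⟨⟨ι.toAddMonoidHom.toIntLinearMap, continuous_of_discreteTopology⟩,
      fun g => ContinuousLinearMap.ext fun x => hequiv g x⟩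
  let gμ : (S.T.ρ k).toTopRep ⟶ ((S.T.ρ k).subrepresentation W hW).toTopRep :=
    TopRep.ofHom ⟨⟨μ.toIntLinearMap, continuous_of_discreteTopology⟩,
      fun g => ContinuousLinearMap.ext fun x => hμ g x⟩
  have hSES : IsSES f gμ :=
    { comp_eq_zero := by
        ext x
        change S.π ^ 1 • ι x = 0
        rw [pow_one]
        exact S.pi_smul_residualInclusion_eq_zero hy k ι hι x
      injective := fun a b h => S.residualInclusion_injective hy k ι hι h
      exact_mid := fun z hz => by
        have hz' : S.π ^ 1 • z = 0 := congrArg Subtype.val hz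
        rw [pow_one] at hz'
        obtain ⟨x, hx⟩ := S.mem_range_residualInclusion_of_smul_eq_zero hy k ι hι z hz'
        exact ⟨x, hx⟩
      surjective := fun w => by
        obtain ⟨z, -, hz⟩ := (Submodule.mem_smul_pointwise_iff_exists _ _ _).1 w.2
        exact ⟨z, Subtype.ext hz⟩ }
  -- `H¹(subtype) ∘ H¹(μ) = H¹(π •) = 0` on `c`, and `H¹(subtype)` is injective
  have hsq := cohomologyMap_one_comm_sq (S.T.ρ k) ((S.T.ρ k).subrepresentation W hW)
    (S.T.ρ k) (S.T.ρ k) μ hμ W.subtype.toAddMonoidHom (fun _ _ => rfl)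
    (AddMonoidHom.id _) (fun _ _ => rfl) (DistribSMul.toAddMonoidHom (N k) (S.π ^ 1))
    (fun g y => (S.T.hlin k g (S.π ^ 1) y).symm) (fun _ => rfl) c
  rw [cohomologyMap_id_apply, cohomologyMap_smul_eq_scalarMapH1 _ (S.T.hlin k), pow_one, hc] at hsq
  have hμc : cohomologyMap gμ 1 c = 0 :=
    S.cohomologyMap_subtype_pow_smul_injective hy k (S.one_le_e hy k) (hsq.trans (map_zero _).symm)
  obtain ⟨a, ha⟩ := hSES.exists_cohomologyMap_eq_of_cohomologyMap_eq_zero 1 c hμc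
  exact ⟨a, ha⟩

/-- **`H¹(K, ι)` identifies `H¹(K, T̄)` with `H¹(K, T^{(k)})[𝔪]`** (injective, image = the `π`-torsion):
`(∃ c̄, H¹(ι) c̄ = c) ↔ π c = 0`. [cite: Howard2004HeegnerKolyvagin, Lemma 1.3.3 (arXiv p. 7 L152–160)] [cite: MazurRubinMemoirs2004, Lemma 3.5.4] -/
theorem exists_cohomologyMap_residualInclusion_eq_iff (hy : S.SatisfiesH) (k : ℕ)
    (ι : Nbar →ₗ[Rk k] N k) (hι : ∀ y : N k, ι (S.πbar k y) = S.π ^ (S.e k - 1) • y)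
    (hequiv : ∀ (σ : absoluteGaloisGroup K) (x : Nbar), ι (S.ρbar σ x) = S.T.ρ k σ (ι x))
    (c : galoisCohomology (S.T.ρ k) 1) :
    (∃ c' : galoisCohomology S.ρbar 1,
      ContinuousRep.cohomologyMap S.ρbar (S.T.ρ k) ι.toAddMonoidHom continuous_of_discreteTopology
        hequiv 1 c' = c) ↔
      galoisCohomology.scalarMapH1 (S.T.ρ k) (S.T.hlin k) S.π c = 0 := by
  constructor
  · rintro ⟨c', rfl⟩
    exact S.scalarMapH1_pi_cohomologyMap_residualInclusion hy k ι hι hequiv c'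
  · exact S.exists_cohomologyMap_residualInclusion_eq_of_scalarMapH1_eq_zero hy k ι hι hequiv c

/-! ## §3 (C̄) The cartesian identity `F̄_v = H¹(K_v, ι)⁻¹(F_{k,v})` at every place, and Selmer descent -/

/-- **(C̄1) At `v ∈ Σ(F)`: `H¹(K_v, ι)⁻¹(F_{k,v})` is `F_k` propagated to `T̄` along `π̄_k`** — H.3 on `T^{(k)}`
(`SatisfiesH.h3`: `F_k` is cartesian on `Quot(T^{(k)})` over `R_k`) for the presentations
`π̄_k : T^{(k)} ↠ T̄ = T^{(k)}/𝔪` (H.1) and `id : T^{(k)} ↠ T^{(k)}/0`, and the injective `Quot`-morphism `ι`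
(`ι ∘ π̄_k = π̄^{e_k-1}`, `π̄^{e_k-1} 𝔪 = 0`, Def. 1.1.3).
[cite: Howard2004HeegnerKolyvagin, H.3, Def. 1.1.2–1.1.3 and Lemma 1.3.3 (arXiv p. 5 L88–99, p. 7 L65–67 and L152–160)] -/
theorem comap_residualInclusionLoc_cond_eq_of_mem (hy : S.SatisfiesH) (k : ℕ) (ι : Nbar →ₗ[Rk k] N k)
    (hι : ∀ y : N k, ι (S.πbar k y) = S.π ^ (S.e k - 1) • y)
    (hequiv : ∀ (σ : absoluteGaloisGroup K) (x : Nbar), ι (S.ρbar σ x) = S.T.ρ k σ (ι x))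
    (v : Place K) (hv : v ∈ S.Sigma) :
    ((S.t k).cond v).comap
        (ContinuousRep.cohomologyMap (S.ρbar.toLocal v) ((S.T.ρ k).toLocal v) ι.toAddMonoidHom
          continuous_of_discreteTopology (fun _ x => hequiv _ x) 1) =
      ((hy.h1 k).1.propagateStructure (S.t k).cond) v := by
  set ϖ : Rk k := algebraMap R (Rk k) S.π with hϖ
  have hJ : IsQuotientBy (S.T.ρ k) (⊥ : Ideal (Rk k)) (S.T.ρ k) LinearMap.id :=
    { surjective := Function.surjective_id
      ker_eq := by rw [LinearMap.ker_id, Submodule.bot_smul]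
      equivariant := fun _ _ => rfl }
  have hf : IsQuotMorphism (S.T.ρ k) (IsLocalRing.maximalIdeal (Rk k)) ⊥ S.ρbar (S.πbar k) (S.T.ρ k)
      LinearMap.id (ϖ ^ (S.e k - 1)) ι :=
    { smul_le := fun x hx => by
        obtain ⟨a', rfl⟩ := S.exists_eq_algebraMap_pi_mul hy k x hx
        rw [Ideal.mem_bot, ← mul_assoc, ← pow_succ, Nat.sub_add_cancel (S.one_le_e hy k), hϖ,
          S.algebraMap_pi_pow_e hy k, zero_mul]
      comp_eq := fun m => by
        rw [hι, LinearMap.id_apply, hϖ, ← map_pow, algebraMap_smul]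
      equivariant := hequiv }
  have hv' : v ∈ (S.t k).Sigma := by rwa [hy.Sigma_eq]
  have hcart := hy.h3 k v hv' _ _ Nbar (N k) S.ρbar (S.πbar k) (S.T.ρ k) LinearMap.id (hy.h1 k).1 hJ
    _ ι hf (S.residualInclusion_injective hy k ι hι)
  have h2 : hJ.propagate v ((S.t k).cond v) = (S.t k).cond v := by
    ext x
    constructor
    · rintro ⟨y, hy', rfl⟩
      rwa [show hJ.localCohomologyMap v 1 y = y from cohomologyMap_id_apply _ y]
    · intro hx
      exact ⟨x, hx, cohomologyMap_id_apply _ x⟩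
  rw [h2] at hcart
  exact hcart.symm

/-- The residual representation is unramified wherever the level is: the inertia group acts trivially on
`T̄ = π̄_k(T^{(k)})` off `Σ(F)`. [cite: Howard2004HeegnerKolyvagin, Def. 1.1.10 and H.1 (arXiv p. 6 L14–24, p. 7 L59)] -/
theorem toLocal_residual_apply_eq_self_of_not_mem (hy : S.SatisfiesH) (k : ℕ) (v : HeightOneSpectrum (𝓞 K))
    (hv : (Sum.inr v : Place K) ∉ S.Sigma) {τ : absoluteGaloisGroup (v.adicCompletion K)}
    (hτ : τ ∈ absInertia (v.adicCompletion K)) (x : Nbar) : GaloisRep.toLocal v S.ρbar τ x = x := by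
  have hvk : (Sum.inr v : Place K) ∉ (S.t k).Sigma := by rwa [hy.Sigma_eq]
  have hur : GaloisRep.IsUnramifiedAt v (S.T.ρ k) :=
    not_not.1 fun h => hvk ((S.t k).isHoward.mem_of_ramified v h)
  obtain ⟨y, rfl⟩ := (hy.h1 k).1.surjective x
  rw [GaloisRep.toLocal_apply, ← (hy.h1 k).1.equivariant]
  exact congrArg (S.πbar k) (GaloisRep.toLocal_apply_eq_self_of_isUnramifiedAt _ hur hτ y)

/-- **(C̄2) At a finite `v ∉ Σ(F)` («unramified cartesian»): `H¹(K_v, ι)⁻¹(H¹_ur(K_v, T^{(k)})) = H¹_ur(K_v, T̄) =`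
the condition propagated from `T^{(k)}`.**  Off `Σ(F)` the level condition is the unramified one and `T^{(k)}`,
hence `T̄`, is unramified at `v`, so a class is unramified iff a representing cocycle VANISHES on `I_{K_v}`
(`oneCocycleClass_mem_unramifiedSubgroup_iff_forall_eq_zero`), a property `ι` reflects (injective); and the
propagated condition on `T̄` is the unramified one (`IsQuotientBy.propagateStructure_inr_eq_unramifiedSubgroup`).
[cite: Howard2004HeegnerKolyvagin, Def. 1.1.10 and §1.3 «Lemma (unramified cartesian)» (arXiv p. 6 L14–24, p. 7 L116–118)] [cite: MazurRubinMemoirs2004, Lemma 1.1.9 and Lemma 3.5.4] -/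
theorem comap_residualInclusionLoc_cond_eq_of_not_mem (hy : S.SatisfiesH) (k : ℕ) (ι : Nbar →ₗ[Rk k] N k)
    (hι : ∀ y : N k, ι (S.πbar k y) = S.π ^ (S.e k - 1) • y)
    (hequiv : ∀ (σ : absoluteGaloisGroup K) (x : Nbar), ι (S.ρbar σ x) = S.T.ρ k σ (ι x))
    (v : HeightOneSpectrum (𝓞 K)) (hv : (Sum.inr v : Place K) ∉ S.Sigma) :
    ((S.t k).cond (Sum.inr v)).comap
        (ContinuousRep.cohomologyMap (S.ρbar.toLocal (Sum.inr v)) ((S.T.ρ k).toLocal (Sum.inr v))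
          ι.toAddMonoidHom continuous_of_discreteTopology (fun _ x => hequiv _ x) 1) =
      ((hy.h1 k).1.propagateStructure (S.t k).cond) (Sum.inr v) := by
  haveI : Finite (N k) := S.finite_level hy k
  have hvk : (Sum.inr v : Place K) ∉ (S.t k).Sigma := by rwa [hy.Sigma_eq]
  have hur : GaloisRep.IsUnramifiedAt v (S.T.ρ k) :=
    not_not.1 fun h => hvk ((S.t k).isHoward.mem_of_ramified v h)
  have hcond : (S.t k).cond (Sum.inr v) =
      DiscreteGaloisModule.unramifiedSubgroup (GaloisRep.toLocal v (S.T.ρ k)) 1 :=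
    (S.t k).isHoward.isUnramifiedOutside.2 v hvk
  rw [(hy.h1 k).1.propagateStructure_inr_eq_unramifiedSubgroup (S.t k).cond hcond hur, hcond]
  have hI : ∀ τ ∈ absInertia (v.adicCompletion K), ∀ w : N k, GaloisRep.toLocal v (S.T.ρ k) τ w = w :=
    fun _ hτ w => GaloisRep.toLocal_apply_eq_self_of_isUnramifiedAt _ hur hτ w
  have hIbar : ∀ τ ∈ absInertia (v.adicCompletion K), ∀ x : Nbar, GaloisRep.toLocal v S.ρbar τ x = x :=
    fun _ hτ x => S.toLocal_residual_apply_eq_self_of_not_mem hy k v hv hτ x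
  ext c
  obtain ⟨z, rfl⟩ := oneCocycleClass_surjective _ c
  rw [AddSubgroup.mem_comap]
  change ContinuousRep.cohomologyMap (S.ρbar.toLocal (Sum.inr v)) ((S.T.ρ k).toLocal (Sum.inr v))
      ι.toAddMonoidHom continuous_of_discreteTopology (fun _ x => hequiv _ x) 1 (oneCocycleClass _ z) ∈ _ ↔ _
  rw [cohomologyMap_one_oneCocycleClass]
  refine (DiscreteGaloisModule.oneCocycleClass_mem_unramifiedSubgroup_iff_forall_eq_zero
    (GaloisRep.toLocal v (S.T.ρ k)) hI _).trans
    (Iff.trans (forall₂_congr fun τ _ => ?_)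
      (DiscreteGaloisModule.oneCocycleClass_mem_unramifiedSubgroup_iff_forall_eq_zero
        (GaloisRep.toLocal v S.ρbar) hIbar z).symm)
  change ι (z.1 τ) = 0 ↔ z.1 τ = 0
  exact map_eq_zero_iff _ (S.residualInclusion_injective hy k ι hι)

/-- **(C̄) At EVERY place: `H¹(K_v, ι)⁻¹(F_{k,v}) = F̄_v`**, `F̄` = `F_k` propagated to `T̄` along `π̄_k` (the residual
Selmer structure of H.5(b)); `Σ(F)` contains the archimedean places, (C̄1) on `Σ(F)`, (C̄2) off it.
[cite: Howard2004HeegnerKolyvagin, H.3, Def. 1.1.3, Lemma 1.3.3 (arXiv p. 5 L93–99, p. 7 L65–67 and L152–160)] -/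
theorem comap_residualInclusionLoc_cond_eq (hy : S.SatisfiesH) (k : ℕ) (ι : Nbar →ₗ[Rk k] N k)
    (hι : ∀ y : N k, ι (S.πbar k y) = S.π ^ (S.e k - 1) • y)
    (hequiv : ∀ (σ : absoluteGaloisGroup K) (x : Nbar), ι (S.ρbar σ x) = S.T.ρ k σ (ι x))
    (v : Place K) :
    ((S.t k).cond v).comap
        (ContinuousRep.cohomologyMap (S.ρbar.toLocal v) ((S.T.ρ k).toLocal v) ι.toAddMonoidHom
          continuous_of_discreteTopology (fun _ x => hequiv _ x) 1) =
      ((hy.h1 k).1.propagateStructure (S.t k).cond) v := by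
  by_cases hv : v ∈ S.Sigma
  · exact S.comap_residualInclusionLoc_cond_eq_of_mem hy k ι hι hequiv v hv
  · rcases v with w | v
    · exact absurd ((hy.Sigma_eq k) ▸ (S.t k).isHoward.isUnramifiedOutside.1 w) hv
    · exact S.comap_residualInclusionLoc_cond_eq_of_not_mem hy k ι hι hequiv v hv

/-- **Selmer descent along `ι`: `H¹(K, ι) c̄ ∈ H¹_F(K, T^{(k)}) ↔ c̄ ∈ H¹_{F̄}(K, T̄)`** (`F̄` = `F_k` propagated to
`T̄`): localisation commutes with `H¹(ι)`, and (C̄). [cite: Howard2004HeegnerKolyvagin, Lemma 1.3.3 (arXiv p. 7 L152–160)] [cite: MazurRubinMemoirs2004, Lemma 3.5.4] -/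
theorem cohomologyMap_residualInclusion_mem_selmerGroup_iff (hy : S.SatisfiesH) (k : ℕ)
    (ι : Nbar →ₗ[Rk k] N k) (hι : ∀ y : N k, ι (S.πbar k y) = S.π ^ (S.e k - 1) • y)
    (hequiv : ∀ (σ : absoluteGaloisGroup K) (x : Nbar), ι (S.ρbar σ x) = S.T.ρ k σ (ι x))
    (c : galoisCohomology S.ρbar 1) :
    ContinuousRep.cohomologyMap S.ρbar (S.T.ρ k) ι.toAddMonoidHom continuous_of_discreteTopology hequiv 1 c ∈
        ((S.t k).cond).selmerGroup ↔
      c ∈ ((hy.h1 k).1.propagateStructure (S.t k).cond).selmerGroup := by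
  refine (SelmerStructure.mem_selmerGroup_iff ((S.t k).cond) _).trans
    (Iff.trans (forall_congr' fun v => ?_) (SelmerStructure.mem_selmerGroup_iff _ c).symm)
  rw [localization_cohomologyMap_one, ← S.comap_residualInclusionLoc_cond_eq hy k ι hι hequiv v]
  exact Iff.rfl

/-- **Howard's Lemma 1.3.3 (`i = 1`) between `T̄` and the level `T^{(k)}` of a `DVRSetting` with H.0–H.5**:
a class `c ∈ H¹(K, T^{(k)})` is an `F`-Selmer class killed by `π` iff `c = H¹(K, ι) c̄` for a (unique,
`cohomologyMap_residualInclusion_injective`) `F̄`-Selmer class `c̄ ∈ H¹_{F̄}(K, T̄)` — «`H¹_F(K, T/𝔪T) ≅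
H¹_F(K, T)[𝔪]`» for `T = T^{(k)}`, i.e. `H¹_{F̄}(K, T̄) ≅ H¹_F(K, T^{(k)})[𝔪]`.  No hypothesis on the exponents
`e` of the tower (level-interpolation-free).
[cite: Howard2004HeegnerKolyvagin, Lemma 1.3.3 (arXiv Lemma 2.3.3, p. 7 L152–160)] [cite: MazurRubinMemoirs2004, Lemma 3.5.4] -/
theorem exists_mem_selmerGroup_cohomologyMap_residualInclusion_eq_iff (hy : S.SatisfiesH) (k : ℕ)
    (ι : Nbar →ₗ[Rk k] N k) (hι : ∀ y : N k, ι (S.πbar k y) = S.π ^ (S.e k - 1) • y)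
    (hequiv : ∀ (σ : absoluteGaloisGroup K) (x : Nbar), ι (S.ρbar σ x) = S.T.ρ k σ (ι x))
    (c : galoisCohomology (S.T.ρ k) 1) :
    (∃ c' ∈ ((hy.h1 k).1.propagateStructure (S.t k).cond).selmerGroup,
        ContinuousRep.cohomologyMap S.ρbar (S.T.ρ k) ι.toAddMonoidHom continuous_of_discreteTopology
          hequiv 1 c' = c) ↔
      c ∈ ((S.t k).cond).selmerGroup ∧
        galoisCohomology.scalarMapH1 (S.T.ρ k) (S.T.hlin k) S.π c = 0 := by
  constructor
  · rintro ⟨c', hc', rfl⟩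
    exact ⟨(S.cohomologyMap_residualInclusion_mem_selmerGroup_iff hy k ι hι hequiv c').2 hc',
      S.scalarMapH1_pi_cohomologyMap_residualInclusion hy k ι hι hequiv c'⟩
  · rintro ⟨hc, h0⟩
    obtain ⟨c', rfl⟩ :=
      S.exists_cohomologyMap_residualInclusion_eq_of_scalarMapH1_eq_zero hy k ι hι hequiv c h0
    exact ⟨c', (S.cohomologyMap_residualInclusion_mem_selmerGroup_iff hy k ι hι hequiv c').1 hc, rfl⟩

/-- **Subgroup form: `H¹(K, ι)(H¹_{F̄}(K, T̄)) = H¹_F(K, T^{(k)})[π]`** (the image of the residual Selmer group is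
the `𝔪`-torsion of the level-`k` Selmer group). [cite: Howard2004HeegnerKolyvagin, Lemma 1.3.3 (arXiv Lemma 2.3.3, p. 7 L152–160)] [cite: MazurRubinMemoirs2004, Lemma 3.5.4] -/
theorem map_cohomologyMap_residualInclusion_selmerGroup_eq (hy : S.SatisfiesH) (k : ℕ)
    (ι : Nbar →ₗ[Rk k] N k) (hι : ∀ y : N k, ι (S.πbar k y) = S.π ^ (S.e k - 1) • y)
    (hequiv : ∀ (σ : absoluteGaloisGroup K) (x : Nbar), ι (S.ρbar σ x) = S.T.ρ k σ (ι x)) :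
    (((hy.h1 k).1.propagateStructure (S.t k).cond).selmerGroup).map
        (ContinuousRep.cohomologyMap S.ρbar (S.T.ρ k) ι.toAddMonoidHom continuous_of_discreteTopology
          hequiv 1) =
      ((S.t k).cond).selmerGroup ⊓ (galoisCohomology.scalarMapH1 (S.T.ρ k) (S.T.hlin k) S.π).ker := by
  ext c
  refine AddSubgroup.mem_map.trans ((S.exists_mem_selmerGroup_cohomologyMap_residualInclusion_eq_iff hy k
    ι hι hequiv c).trans ?_)
  exact Iff.rfl

/-! ## §4 The same for `F(n)` (transverse at the primes of `n`, on `T^{(k)}` and on `T̄`) -/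

/-- **(C̄ₙ) The cartesian identity for `F(n)` at EVERY place**: `H¹(K_v, ι)⁻¹(F(n)_{k,v}) = F̄(n)_v`, where
`F̄(n)` is the propagated structure `F̄` made transverse at the primes of `n` (Def. 1.2.2 on `T̄`), for `n` a
finite set of primes at which `Γ_L` acts trivially on `T^{(k)}` (print: `n ∈ 𝓝^{(k)}`): at `w ∈ n` both
conditions are transverse and `ι` is injective with `Γ_L` trivial on the target (Lemma 1.5.1,
`comap_cohomologyMap_transverseCondition_eq`); elsewhere `F(n) = F` and this is (C̄).
[cite: Howard2004HeegnerKolyvagin, Def. 1.2.2, Lemma 1.5.1 and Lemma 1.3.3 (arXiv p. 6 L101–125, p. 9 L127–133, p. 7 L152–160)] [cite: MazurRubinMemoirs2004, Lemma 3.7.4] -/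
theorem comap_residualInclusionLoc_atLevel_cond_eq (hy : S.SatisfiesH) (k : ℕ) (ι : Nbar →ₗ[Rk k] N k)
    (hι : ∀ y : N k, ι (S.πbar k y) = S.π ^ (S.e k - 1) • y)
    (hequiv : ∀ (σ : absoluteGaloisGroup K) (x : Nbar), ι (S.ρbar σ x) = S.T.ρ k σ (ι x))
    (n : Finset (HeightOneSpectrum (𝓞 K)))
    (htriv : ∀ w ∈ n, ∀ g ∈ transverseFixer p (residueChar w) S.jbar w, ∀ y : N k,
      GaloisRep.toLocal w (S.T.ρ k) g y = y)
    (v : Place K) :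
    (((S.t k).atLevel S.jbar n).cond v).comap
        (ContinuousRep.cohomologyMap (S.ρbar.toLocal v) ((S.T.ρ k).toLocal v) ι.toAddMonoidHom
          continuous_of_discreteTopology (fun _ x => hequiv _ x) 1) =
      (((hy.h1 k).1.propagateStructure (S.t k).cond).modify (transverseStructure p S.ρbar S.jbar) ∅ ∅ n)
        v := by
  rcases v with w | w
  · rw [(S.t k).atLevel_cond_inl, SelmerStructure.modify_inl]
    exact S.comap_residualInclusionLoc_cond_eq hy k ι hι hequiv (Sum.inl w)
  · by_cases hw : w ∈ n
    · rw [(S.t k).atLevel_cond_inr_of_mem S.jbar hw, SelmerStructure.modify_inr,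
        if_neg (Finset.notMem_empty w), if_neg (Finset.notMem_empty w), if_pos hw, transverseStructure_inr]
      exact comap_cohomologyMap_transverseCondition_eq S.ρbar (S.T.ρ k) (residueChar w) S.jbar w
        ι.toAddMonoidHom (S.residualInclusion_injective hy k ι hι) (fun _ x => hequiv _ x) (htriv w hw)
    · rw [(S.t k).atLevel_cond_inr_of_not_mem S.jbar hw, SelmerStructure.modify_inr,
        if_neg (Finset.notMem_empty w), if_neg (Finset.notMem_empty w), if_neg hw]
      exact S.comap_residualInclusionLoc_cond_eq hy k ι hι hequiv (Sum.inr w)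

/-- **Selmer descent along `ι` for `F(n)`**: `H¹(K, ι) c̄ ∈ H¹_{F(n)}(K, T^{(k)}) ↔ c̄ ∈ H¹_{F̄(n)}(K, T̄)`.
[cite: Howard2004HeegnerKolyvagin, Lemma 1.3.3 at level n, as used in Lemma 1.6.4 (arXiv p. 7 L152–160, p. 11 L95–97, p. 12 L1–9)] [cite: MazurRubinMemoirs2004, Lemma 3.5.4] -/
theorem cohomologyMap_residualInclusion_mem_selmerGroup_atLevel_iff (hy : S.SatisfiesH) (k : ℕ)
    (ι : Nbar →ₗ[Rk k] N k) (hι : ∀ y : N k, ι (S.πbar k y) = S.π ^ (S.e k - 1) • y)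
    (hequiv : ∀ (σ : absoluteGaloisGroup K) (x : Nbar), ι (S.ρbar σ x) = S.T.ρ k σ (ι x))
    (n : Finset (HeightOneSpectrum (𝓞 K)))
    (htriv : ∀ w ∈ n, ∀ g ∈ transverseFixer p (residueChar w) S.jbar w, ∀ y : N k,
      GaloisRep.toLocal w (S.T.ρ k) g y = y)
    (c : galoisCohomology S.ρbar 1) :
    ContinuousRep.cohomologyMap S.ρbar (S.T.ρ k) ι.toAddMonoidHom continuous_of_discreteTopology hequiv 1 c ∈
        (((S.t k).atLevel S.jbar n).cond).selmerGroup ↔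
      c ∈ ((((hy.h1 k).1.propagateStructure (S.t k).cond).modify (transverseStructure p S.ρbar S.jbar)
        ∅ ∅ n)).selmerGroup := by
  refine (SelmerStructure.mem_selmerGroup_iff (((S.t k).atLevel S.jbar n).cond) _).trans
    (Iff.trans (forall_congr' fun v => ?_) (SelmerStructure.mem_selmerGroup_iff _ c).symm)
  rw [localization_cohomologyMap_one,
    ← S.comap_residualInclusionLoc_atLevel_cond_eq hy k ι hι hequiv n htriv v]
  exact Iff.rfl

/-- **The «(H.5 application)» identification of the proof of Lemma 1.6.4: `H¹_{F̄(n)}(K, T̄) ≅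
H¹_{F(n)}(K, T^{(k)})[𝔪]` via `H¹(K, ι)`** — a class `c ∈ H¹(K, T^{(k)})` is an `F(n)`-Selmer class killed by
`π` iff `c = H¹(K, ι) c̄` for a (unique) `F̄(n)`-Selmer class `c̄` of `T̄`; for `n` a finite set of primes at
which `Γ_L` acts trivially on `T^{(k)}` (`n ∈ 𝓝^{(k)}`).  With this, «`d ∈ H¹_{F(n)}(K,T^{(k)})[𝔪]`» (Case i/ii)
is a class of `H¹_{F(n)}(K, T̄)` and `ρ(n) = dim H¹_{F(n)}(K, T̄) = len H¹_{F(n)}(K, T^{(k)})[𝔪]`.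
[cite: Howard2004HeegnerKolyvagin, Lemma 1.3.3 with Lemma 1.5.1, Lemma 1.6.4 proof (arXiv p. 7 L152–160, p. 9 L127–133, p. 11 L95–97, p. 12 L1–9)] [cite: MazurRubinMemoirs2004, Lemma 3.5.4] -/
theorem exists_mem_selmerGroup_atLevel_cohomologyMap_residualInclusion_eq_iff (hy : S.SatisfiesH) (k : ℕ)
    (ι : Nbar →ₗ[Rk k] N k) (hι : ∀ y : N k, ι (S.πbar k y) = S.π ^ (S.e k - 1) • y)
    (hequiv : ∀ (σ : absoluteGaloisGroup K) (x : Nbar), ι (S.ρbar σ x) = S.T.ρ k σ (ι x))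
    (n : Finset (HeightOneSpectrum (𝓞 K)))
    (htriv : ∀ w ∈ n, ∀ g ∈ transverseFixer p (residueChar w) S.jbar w, ∀ y : N k,
      GaloisRep.toLocal w (S.T.ρ k) g y = y)
    (c : galoisCohomology (S.T.ρ k) 1) :
    (∃ c' ∈ ((((hy.h1 k).1.propagateStructure (S.t k).cond).modify (transverseStructure p S.ρbar S.jbar)
        ∅ ∅ n)).selmerGroup,
        ContinuousRep.cohomologyMap S.ρbar (S.T.ρ k) ι.toAddMonoidHom continuous_of_discreteTopology
          hequiv 1 c' = c) ↔
      c ∈ (((S.t k).atLevel S.jbar n).cond).selmerGroup ∧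
        galoisCohomology.scalarMapH1 (S.T.ρ k) (S.T.hlin k) S.π c = 0 := by
  constructor
  · rintro ⟨c', hc', rfl⟩
    exact ⟨(S.cohomologyMap_residualInclusion_mem_selmerGroup_atLevel_iff hy k ι hι hequiv n htriv c').2 hc',
      S.scalarMapH1_pi_cohomologyMap_residualInclusion hy k ι hι hequiv c'⟩
  · rintro ⟨hc, h0⟩
    obtain ⟨c', rfl⟩ :=
      S.exists_cohomologyMap_residualInclusion_eq_of_scalarMapH1_eq_zero hy k ι hι hequiv c h0
    exact ⟨c', (S.cohomologyMap_residualInclusion_mem_selmerGroup_atLevel_iff hy k ι hι hequiv n htriv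
      c').1 hc, rfl⟩

/-- **Subgroup form for `F(n)`: `H¹(K, ι)(H¹_{F̄(n)}(K, T̄)) = H¹_{F(n)}(K, T^{(k)})[π]`.**
[cite: Howard2004HeegnerKolyvagin, Lemma 1.3.3 with Lemma 1.5.1, Lemma 1.6.4 proof (arXiv p. 7 L152–160, p. 9 L127–133, p. 11 L95–97)] [cite: MazurRubinMemoirs2004, Lemma 3.5.4] -/
theorem map_cohomologyMap_residualInclusion_selmerGroup_atLevel_eq (hy : S.SatisfiesH) (k : ℕ)
    (ι : Nbar →ₗ[Rk k] N k) (hι : ∀ y : N k, ι (S.πbar k y) = S.π ^ (S.e k - 1) • y)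
    (hequiv : ∀ (σ : absoluteGaloisGroup K) (x : Nbar), ι (S.ρbar σ x) = S.T.ρ k σ (ι x))
    (n : Finset (HeightOneSpectrum (𝓞 K)))
    (htriv : ∀ w ∈ n, ∀ g ∈ transverseFixer p (residueChar w) S.jbar w, ∀ y : N k,
      GaloisRep.toLocal w (S.T.ρ k) g y = y) :
    (((((hy.h1 k).1.propagateStructure (S.t k).cond).modify (transverseStructure p S.ρbar S.jbar)
        ∅ ∅ n)).selmerGroup).map
        (ContinuousRep.cohomologyMap S.ρbar (S.T.ρ k) ι.toAddMonoidHom continuous_of_discreteTopology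
          hequiv 1) =
      (((S.t k).atLevel S.jbar n).cond).selmerGroup ⊓
        (galoisCohomology.scalarMapH1 (S.T.ρ k) (S.T.hlin k) S.π).ker := by
  ext c
  refine AddSubgroup.mem_map.trans
    ((S.exists_mem_selmerGroup_atLevel_cohomologyMap_residualInclusion_eq_iff hy k ι hι hequiv n htriv
      c).trans ?_)
  exact Iff.rfl

end DVRSetting

end Literature.NumberTheory.GaloisCohomology.Howard2004

end
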